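import Mathlib

/-!
# Edge-set degrees, the handshake lemma and the odd-path lemma (seat p1, gen 1)

Combinatorial core of the «at least one» half of P6(a) · DUAL-CROSSING (proofs/P6-dualcrossing-p1-v1.md §3,
steps (iii)–(vi)), stated for a finite set `E` of unordered pairs (the edges of the graph `H = (B*_n, 𝒦*)` of
the paper file) with the degree `edeg E v = |{e ∈ E : v ∈ e}|`:

* `sum_edeg`: the handshake identity `Σ_v edeg E v = 2|E|` over any finset containing the endpoints;
* `even_card_odd_edeg`: the number of odd-degree vertices is even;
* `exists_reachable_of_odd`: if every odd-degree vertex lies in `T ∪ B` and `T` contains an odd number of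
  odd-degree vertices, then some vertex of `T` is joined to some vertex of `B` by a walk using edges of `E`
  (P6 §3 (vi); the same argument as the landed `OddPath.exists_odd_reachable`, in edge-set form);
* `even_xor_cycle`: around a 4-cycle, membership in a set switches an even number of times (P6 §3 (iii));
* `odd_switch_count`: along a row that starts inside and ends outside a set, membership switches an odd
  number of times (P6 §3 (v)).

Imports Mathlib only; no probability, no definitions beyond `edeg` and `endpoints`.
-/

namespace Summit.Ventures.PercRepro0.EdgeParity

variable {V : Type*} [DecidableEq V]

/-- The degree of `v` in the finite edge set `E`: the number of edges of `E` containing `v`. -/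
def edeg (E : Finset (Sym2 V)) (v : V) : ℕ := (E.filter (fun e => v ∈ e)).card

/-- The two endpoints of an unordered pair, as a finset. -/
def endpoints (e : Sym2 V) : Finset V :=
  Sym2.lift ⟨fun a b => ({a, b} : Finset V), fun a b => Finset.pair_comm a b⟩ e

/-- `endpoints` on a pair. -/
theorem endpoints_mk (a b : V) : endpoints s(a, b) = {a, b} := rfl

/-- Membership in the endpoints. -/
theorem mem_endpoints (e : Sym2 V) (v : V) : v ∈ endpoints e ↔ v ∈ e := by
  induction e using Sym2.ind with
  | h a b =>
    rw [endpoints_mk, Finset.mem_insert, Finset.mem_singleton, Sym2.mem_iff]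

/-- A non-diagonal pair has two endpoints. -/
theorem card_endpoints (e : Sym2 V) (he : ¬ e.IsDiag) : (endpoints e).card = 2 := by
  induction e using Sym2.ind with
  | h a b =>
    rw [Sym2.mk_isDiag_iff] at he
    rw [endpoints_mk]
    exact Finset.card_pair he

/-- The degree as a sum of indicators. -/
theorem edeg_eq_sum (E : Finset (Sym2 V)) (v : V) :
    edeg E v = ∑ e ∈ E, if v ∈ e then 1 else 0 := by
  rw [edeg, Finset.card_filter]

/-- **Handshake**: over a finset `S` containing every endpoint of `E`, the degrees sum to `2|E|`. -/
theorem sum_edeg (E : Finset (Sym2 V)) (hE : ∀ e ∈ E, ¬ e.IsDiag) (S : Finset V)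
    (hS : ∀ e ∈ E, ∀ v ∈ e, v ∈ S) : ∑ v ∈ S, edeg E v = 2 * E.card := by
  simp only [edeg_eq_sum]
  rw [Finset.sum_comm]
  have h2 : ∀ e ∈ E, (∑ v ∈ S, if v ∈ e then 1 else 0) = 2 := by
    intro e he
    rw [← Finset.card_filter]
    have : S.filter (fun v => v ∈ e) = endpoints e := by
      ext v
      simp only [Finset.mem_filter, mem_endpoints]
      exact ⟨fun h => h.2, fun h => ⟨hS e he v h, h⟩⟩
    rw [this, card_endpoints e (hE e he)]
  rw [Finset.sum_congr rfl h2, Finset.sum_const, smul_eq_mul, mul_comm]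

/-- The number of odd-degree vertices (in a finset containing all endpoints) is even. -/
theorem even_card_odd_edeg (E : Finset (Sym2 V)) (hE : ∀ e ∈ E, ¬ e.IsDiag) (S : Finset V)
    (hS : ∀ e ∈ E, ∀ v ∈ e, v ∈ S) : Even (S.filter (fun v => Odd (edeg E v))).card := by
  rw [← Finset.even_sum_iff_even_card_odd, sum_edeg E hE S hS]
  exact even_two_mul _

/-- A vertex of positive degree lies on some edge of `E`. -/
theorem exists_mem_of_edeg_pos (E : Finset (Sym2 V)) (v : V) (h : 0 < edeg E v) :
    ∃ e ∈ E, v ∈ e := by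
  rw [edeg, Finset.card_pos] at h
  obtain ⟨e, he⟩ := h
  rw [Finset.mem_filter] at he
  exact ⟨e, he.1, he.2⟩

/-- **Odd vertices force a connection** (P6 §3 (vi)). If every odd-degree vertex of `E` lies in `T ∪ B`
and `T` contains an odd number of odd-degree vertices, then some vertex of `T` is joined to some vertex
of `B` by a walk with all its edges in `E`. -/
theorem exists_reachable_of_odd (E : Finset (Sym2 V)) (hE : ∀ e ∈ E, ¬ e.IsDiag) (T B : Finset V)
    (hodd : ∀ v, Odd (edeg E v) → v ∈ T ∨ v ∈ B)
    (hT : Odd (T.filter (fun v => Odd (edeg E v))).card) :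
    ∃ t ∈ T, ∃ b ∈ B, (SimpleGraph.fromEdgeSet (E : Set (Sym2 V))).Reachable t b := by
  classical
  by_contra hcon
  have hcon' : ∀ t ∈ T, ∀ b ∈ B, ¬ (SimpleGraph.fromEdgeSet (E : Set (Sym2 V))).Reachable t b :=
    fun t ht b hb h => hcon ⟨t, ht, b, hb, h⟩
  -- the vertices reachable from an odd-degree vertex of `T`
  let R : Set V := {v | ∃ t ∈ T, Odd (edeg E t) ∧ (SimpleGraph.fromEdgeSet (E : Set (Sym2 V))).Reachable t v}
  have hclosed : ∀ e ∈ E, ∀ u ∈ e, ∀ v ∈ e, u ∈ R → v ∈ R := by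
    rintro e he u hu v hv ⟨t, ht, hodd_t, hreach⟩
    by_cases huv : u = v
    · subst huv; exact ⟨t, ht, hodd_t, hreach⟩
    · refine ⟨t, ht, hodd_t, hreach.trans (SimpleGraph.Adj.reachable ?_)⟩
      rw [SimpleGraph.fromEdgeSet_adj]
      refine ⟨?_, huv⟩
      have : e = s(u, v) := (Sym2.mem_and_mem_iff huv).1 ⟨hu, hv⟩
      rw [← this]
      exact he
  -- the edges touching `R` (all their endpoints lie in `R`)
  let ER : Finset (Sym2 V) := E.filter (fun e => ∃ u ∈ e, u ∈ R)
  have hER_sub : ∀ e ∈ ER, e ∈ E := fun e he => (Finset.mem_filter.1 he).1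
  have hdeg_of_mem : ∀ v ∈ R, edeg ER v = edeg E v := by
    intro v hv
    unfold edeg
    congr 1
    ext e
    simp only [Finset.mem_filter, ER]
    exact ⟨fun h => ⟨h.1.1, h.2⟩, fun h => ⟨⟨h.1, v, h.2, hv⟩, h.2⟩⟩
  have hdeg_of_notMem : ∀ v, v ∉ R → edeg ER v = 0 := by
    intro v hv
    unfold edeg
    rw [Finset.card_eq_zero, Finset.filter_eq_empty_iff]
    rintro e he hve
    obtain ⟨he, u, hu, huR⟩ := Finset.mem_filter.1 he
    exact hv (hclosed e he u hu v hve huR)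
  -- the endpoints of `ER`
  let S : Finset V := ER.biUnion endpoints
  have hS : ∀ e ∈ ER, ∀ v ∈ e, v ∈ S := by
    intro e he v hv
    rw [Finset.mem_biUnion]
    exact ⟨e, he, (mem_endpoints e v).2 hv⟩
  have heven := even_card_odd_edeg ER (fun e he => hE e (hER_sub e he)) S hS
  -- the odd-degree vertices of `ER` in `S` are exactly the odd-degree vertices of `E` in `T`
  have hfilter : S.filter (fun v => Odd (edeg ER v)) = T.filter (fun v => Odd (edeg E v)) := by
    ext v
    simp only [Finset.mem_filter]
    constructor
    · rintro ⟨hvS, hoddv⟩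
      have hvR : v ∈ R := by
        by_contra h
        rw [hdeg_of_notMem v h] at hoddv
        exact (Nat.not_even_iff_odd.2 hoddv) ⟨0, rfl⟩
      rw [hdeg_of_mem v hvR] at hoddv
      refine ⟨?_, hoddv⟩
      rcases hodd v hoddv with hvT | hvB
      · exact hvT
      · obtain ⟨t, ht, hodd_t, hreach⟩ := hvR
        exact absurd hreach (hcon' t ht v hvB)
    · rintro ⟨hvT, hoddv⟩
      have hvR : v ∈ R := ⟨v, hvT, hoddv, SimpleGraph.Reachable.refl v⟩
      refine ⟨?_, by rw [hdeg_of_mem v hvR]; exact hoddv⟩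
      obtain ⟨e, he, hve⟩ := exists_mem_of_edeg_pos E v (Nat.pos_of_ne_zero (by
        intro h0; rw [h0] at hoddv; exact (Nat.not_even_iff_odd.2 hoddv) ⟨0, rfl⟩))
      exact hS e (Finset.mem_filter.2 ⟨he, v, hve, hvR⟩) v hve
  rw [hfilter] at heven
  exact (Nat.not_even_iff_odd.2 hT) heven

/-! ## Two parity counts -/

/-- Around a 4-cycle `a → b → c → d → a`, membership switches an even number of times (P6 §3 (iii));
the four edges are written as `ab`, `bc`, `dc`, `ad`, the orientation in which they arise as face edges. -/
theorem even_xor_cycle (a b c d : Prop) [Decidable a] [Decidable b] [Decidable c] [Decidable d] :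
    Even ((if Xor a b then 1 else 0) + (if Xor b c then 1 else 0) + (if Xor d c then 1 else 0)
      + (if Xor a d then 1 else 0) : ℕ) := by
  by_cases ha : a <;> by_cases hb : b <;> by_cases hc : c <;> by_cases hd : d <;>
    simp [Xor, ha, hb, hc, hd] <;> decide

/-- Along `q 0, q 1, …, q m`, the number of switches has the parity of `Xor (q 0) (q m)`. -/
theorem switch_count_mod_two (q : ℕ → Prop) [DecidablePred q] (m : ℕ) :
    (∑ i ∈ Finset.range m, if Xor (q i) (q (i + 1)) then 1 else 0) % 2
      = if Xor (q 0) (q m) then 1 else 0 := by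
  induction m with
  | zero => simp [Xor]
  | succ m ih =>
    rw [Finset.sum_range_succ, Nat.add_mod, ih]
    by_cases h0 : q 0 <;> by_cases hm : q m <;> by_cases hm1 : q (m + 1) <;> simp [Xor, h0, hm, hm1]

/-- A row that starts inside and ends outside a set switches an odd number of times (P6 §3 (v)). -/
theorem odd_switch_count (q : ℕ → Prop) [DecidablePred q] (m : ℕ) (h0 : q 0) (hm : ¬ q m) :
    Odd (∑ i ∈ Finset.range m, if Xor (q i) (q (i + 1)) then 1 else 0) := by
  rw [Nat.odd_iff, switch_count_mod_two]
  simp [Xor, h0, hm]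

end Summit.Ventures.PercRepro0.EdgeParity
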